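import Literature.Probability.LatticeModels.DomainDiscretisation
import Literature.Probability.Percolation.Percolation
import Literature.Probability.Percolation.BoxCrossingProofs
import Mathlib.Combinatorics.SimpleGraph.Walk.Decomp
import Mathlib.Combinatorics.SimpleGraph.Walk.Maps
import HarnessLib

/-!
# Reading open lattice walks as paths of the discrete domain `Ω_δ`

Topic: Probability / Percolation (companion to `LatticeModels/DomainDiscretisation.lean` and
`Percolation/BoxCrossingProofs.lean`). The crossing event `discreteCrossing Ω δ A B` of a
conformal rectangle (`Crossings.lean`; Smirnov 2001, §2) asks for a path of the graph
`openGraph ω ⊓ discreteDomainGraph Ω δ` — open edges of the discrete domain `Ω_δ` — between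
the two discrete arcs. RSW/FKG arguments produce instead *lattice walks* (walks of `zdGraph 2`:
open crossings of rectangles, open circuits in annuli) with open edges. This file bridges the
two:

* `open_inf_discreteDomainGraph_adj_iff` — adjacency in `openGraph ω ⊓ discreteDomainGraph Ω δ`;
* `reachable_of_walk` — an open lattice walk whose closed mesh edges lie in `Ω̄` and whose
  vertices lie in `Ω_δ` joins all its vertices in that graph;
* `exists_exit_or_forall_mem`, `exists_meshBoundary_of_not_adj` — **walking an open circuit out
  of the domain**: an open lattice walk started at a vertex of `Ω_δ` either stays in `Ω_δ`
  (all its edges are mesh edges) or has an exit step `x → y` with `x` a discrete boundary vertex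
  of `Ω_δ` (`meshBoundary`) joined to the start by open edges of `Ω_δ` and `[δx, δy] ⊄ Ω`; in
  particular this happens as soon as some edge of the walk is not a mesh edge (an open circuit
  around a boundary point meets the exterior). This is the step of the folklore proof of the
  RSW corollary `Literature.Probability.Percolation.discreteCrossingProb_bounds_nullFrontier` that turns "an open
  circuit around `a′ ∈ (ab)` glued to the bulk cluster" into "a vertex of the discrete arc of
  `(ab)` joined to the bulk in `Ω_δ`".

Mathlib anchors: `SimpleGraph.Walk.transfer`, `Walk.takeUntil`, `Walk.support_transfer`,
induction on `SimpleGraph.Walk`; H21 anchors: `openGraph`, `meshGraph`, `meshDomain`,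
`discreteDomainGraph`, `meshBoundary`, `Literature.Probability.Percolation.mem_meshDomain_of_meshGraph_adj`.

## References
* S. Smirnov, C. R. Acad. Sci. Paris 333 (2001), §2 (discrete domain and its crossings)
  [Smirnov2001].
* G. Grimmett, *Probability on Graphs*, 2nd ed. (2018), §5.7, Ex. 5.6 (the RSW corollary).
-/

namespace Literature.Probability.Percolation

open Set

noncomputable section

variable {Ω : Set ℂ} {δ : ℝ} {ω : BondConfig (LatticeModels.Site 2)}

/-- Adjacency in the graph `openGraph ω ⊓ discreteDomainGraph Ω δ` of open edges of the discrete
domain (the graph whose reachability defines `discreteCrossing`), unfolded. [folklore] -/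
theorem open_inf_discreteDomainGraph_adj_iff {x y : LatticeModels.Site 2} :
    (openGraph ω ⊓ LatticeModels.discreteDomainGraph Ω δ).Adj x y ↔
      s(x, y) ∈ ω ∧ (LatticeModels.meshGraph Ω δ).Adj x y ∧ x ∈ LatticeModels.meshDomain Ω δ ∧ y ∈ LatticeModels.meshDomain Ω δ := by
  rw [SimpleGraph.inf_adj, openGraph_adj, LatticeModels.discreteDomainGraph_adj_iff]
  constructor
  · rintro ⟨⟨h1, -⟩, h2, h3, h4⟩; exact ⟨h1, h2, h3, h4⟩
  · rintro ⟨h1, h2, h3, h4⟩; exact ⟨⟨h1, h2.ne⟩, h2, h3, h4⟩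

/-- **An open lattice walk inside `Ω_δ` is a walk of the open domain graph.** If all edges of a
lattice walk are open, all its closed mesh edges lie in `Ω̄`, and all its vertices belong to
`Ω_δ`, then every vertex of the walk is joined to its start in `openGraph ω ⊓ discreteDomainGraph Ω δ`.
[folklore] -/
theorem reachable_of_walk {u v : LatticeModels.Site 2} (W : (LatticeModels.zdGraph 2).Walk u v)
    (hopen : ∀ e ∈ W.edges, e ∈ ω)
    (hseg : ∀ x y, s(x, y) ∈ W.edges → segment ℝ (LatticeModels.meshPoint δ x) (LatticeModels.meshPoint δ y) ⊆ closure Ω)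
    (hdom : ∀ x ∈ W.support, x ∈ LatticeModels.meshDomain Ω δ) :
    ∀ x ∈ W.support, (openGraph ω ⊓ LatticeModels.discreteDomainGraph Ω δ).Reachable u x := by
  have hE : ∀ e ∈ W.edges, e ∈ (openGraph ω ⊓ LatticeModels.discreteDomainGraph Ω δ).edgeSet := by
    intro e he
    induction e using Sym2.ind with
    | h x y =>
      rw [SimpleGraph.mem_edgeSet, open_inf_discreteDomainGraph_adj_iff]
      exact ⟨hopen _ he, LatticeModels.meshGraph_adj_iff.2 ⟨W.adj_of_mem_edges he, hseg x y he⟩,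
        hdom x (W.fst_mem_support_of_mem_edges he), hdom y (W.snd_mem_support_of_mem_edges he)⟩
  intro x hx
  set W' := W.transfer (openGraph ω ⊓ LatticeModels.discreteDomainGraph Ω δ) hE with hW'
  have hx' : x ∈ W'.support := by rwa [hW', SimpleGraph.Walk.support_transfer]
  exact ⟨W'.takeUntil x hx'⟩

/-- Inductive form of `exists_exit_or_forall_mem` (arbitrary start `a ∈ Ω_δ` joined to `y₀`).
[folklore] -/
theorem exists_exit_or_forall_mem_aux {y₀ a v : LatticeModels.Site 2} (W : (LatticeModels.zdGraph 2).Walk a v)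
    (ha : a ∈ LatticeModels.meshDomain Ω δ) (hr : (openGraph ω ⊓ LatticeModels.discreteDomainGraph Ω δ).Reachable y₀ a)
    (hopen : ∀ e ∈ W.edges, e ∈ ω) :
    (∃ x y : LatticeModels.Site 2, x ∈ W.support ∧ (LatticeModels.zdGraph 2).Adj x y ∧ s(x, y) ∈ W.edges ∧
        x ∈ LatticeModels.meshDomain Ω δ ∧ (openGraph ω ⊓ LatticeModels.discreteDomainGraph Ω δ).Reachable y₀ x ∧
        ¬ (LatticeModels.discreteDomainGraph Ω δ).Adj x y ∧
        ¬ segment ℝ (LatticeModels.meshPoint δ x) (LatticeModels.meshPoint δ y) ⊆ Ω) ∨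
      ((∀ x ∈ W.support, x ∈ LatticeModels.meshDomain Ω δ ∧ (openGraph ω ⊓ LatticeModels.discreteDomainGraph Ω δ).Reachable y₀ x) ∧
        ∀ x y, s(x, y) ∈ W.edges → (LatticeModels.meshGraph Ω δ).Adj x y) := by
  induction W with
  | nil =>
    right
    exact ⟨fun x hx => by
      rw [SimpleGraph.Walk.support_nil, List.mem_singleton] at hx
      subst hx; exact ⟨ha, hr⟩, fun x y h => by simp at h⟩
  | @cons a b c hab W ih =>
    have hab_open : s(a, b) ∈ ω := hopen _ (by simp)
    have hopen' : ∀ e ∈ W.edges, e ∈ ω := fun e he => hopen e (by simp [he])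
    by_cases hgood : (LatticeModels.meshGraph Ω δ).Adj a b ∧ b ∈ LatticeModels.meshVertices Ω δ
    · -- the step stays in `Ω_δ`
      have hb : b ∈ LatticeModels.meshDomain Ω δ :=
        Literature.Probability.Percolation.mem_meshDomain_of_meshGraph_adj ha hgood.2 hgood.1
      have hadj : (openGraph ω ⊓ LatticeModels.discreteDomainGraph Ω δ).Adj a b :=
        open_inf_discreteDomainGraph_adj_iff.2 ⟨hab_open, hgood.1, ha, hb⟩
      rcases ih hb (hr.trans hadj.reachable) hopen' with h | ⟨h1, h2⟩
      · left
        obtain ⟨x, y, hx, hxy, he, hxd, hxr, hnadj, hseg⟩ := h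
        exact ⟨x, y, by simp [hx], hxy, by simp [he], hxd, hxr, hnadj, hseg⟩
      · right
        refine ⟨fun x hx => ?_, fun x y he => ?_⟩
        · rw [SimpleGraph.Walk.support_cons, List.mem_cons] at hx
          rcases hx with rfl | hx
          · exact ⟨ha, hr⟩
          · exact h1 x hx
        · rw [SimpleGraph.Walk.edges_cons, List.mem_cons] at he
          rcases he with he | he
          · rcases Sym2.eq_iff.1 he with ⟨rfl, rfl⟩ | ⟨rfl, rfl⟩
            · exact hgood.1
            · exact hgood.1.symm
          · exact h2 x y he
    · -- the step `a → b` leaves `Ω_δ`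
      left
      refine ⟨a, b, by simp, hab, by simp, ha, hr, fun hadj => ?_, fun hseg => ?_⟩
      · rw [LatticeModels.discreteDomainGraph_adj_iff] at hadj
        exact hgood ⟨hadj.1, LatticeModels.meshDomain_subset_meshVertices Ω δ hadj.2.2⟩
      · refine hgood ⟨LatticeModels.meshGraph_adj_iff.2 ⟨hab, hseg.trans subset_closure⟩, ?_⟩
        exact hseg (right_mem_segment ℝ _ _)

/-- **Walking an open circuit out of the domain.** Let `W` be a lattice walk starting at a
vertex `y₀ ∈ Ω_δ`, all of whose edges are open. Then either every step of `W` stays in `Ω_δ`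
(each edge is a mesh edge — and then all vertices of `W` are in `Ω_δ` and joined to `y₀` in the
open domain graph), or there is a step `x → y` that leaves: `x ∈ Ω_δ` is joined to `y₀` in the
open domain graph, `x ∼ y` in `ℤ²`, `x` and `y` are not adjacent in `Ω_δ` (so `x` is a
discrete boundary vertex, `mem_meshBoundary`), and the closed mesh edge `[δx, δy]` is not
contained in `Ω` (so it carries a point of `∂Ω` within `δ` of `δx`). [folklore] -/
theorem exists_exit_or_forall_mem {y₀ v : LatticeModels.Site 2} (W : (LatticeModels.zdGraph 2).Walk y₀ v)
    (hy₀ : y₀ ∈ LatticeModels.meshDomain Ω δ) (hopen : ∀ e ∈ W.edges, e ∈ ω) :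
    (∃ x y : LatticeModels.Site 2, x ∈ W.support ∧ (LatticeModels.zdGraph 2).Adj x y ∧ s(x, y) ∈ W.edges ∧
        x ∈ LatticeModels.meshDomain Ω δ ∧ (openGraph ω ⊓ LatticeModels.discreteDomainGraph Ω δ).Reachable y₀ x ∧
        ¬ (LatticeModels.discreteDomainGraph Ω δ).Adj x y ∧
        ¬ segment ℝ (LatticeModels.meshPoint δ x) (LatticeModels.meshPoint δ y) ⊆ Ω) ∨
      ((∀ x ∈ W.support, x ∈ LatticeModels.meshDomain Ω δ ∧ (openGraph ω ⊓ LatticeModels.discreteDomainGraph Ω δ).Reachable y₀ x) ∧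
        ∀ x y, s(x, y) ∈ W.edges → (LatticeModels.meshGraph Ω δ).Adj x y) :=
  exists_exit_or_forall_mem_aux W hy₀ SimpleGraph.Reachable.rfl hopen

/-- **Exit vertex of an open walk with a non-mesh edge.** If an open lattice walk from
`y₀ ∈ Ω_δ` has some edge that is not a mesh edge (its closed segment leaves `Ω̄` — e.g. an open
circuit around a boundary point, which must meet the exterior), then some vertex `x` of the
walk is a discrete boundary vertex of `Ω_δ` joined to `y₀` by open edges of `Ω_δ`, with a
lattice neighbour `y` such that `[δx, δy] ⊄ Ω`. [folklore] -/
theorem exists_meshBoundary_of_not_adj {y₀ v : LatticeModels.Site 2} (W : (LatticeModels.zdGraph 2).Walk y₀ v)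
    (hy₀ : y₀ ∈ LatticeModels.meshDomain Ω δ) (hopen : ∀ e ∈ W.edges, e ∈ ω)
    (hbad : ∃ x y, s(x, y) ∈ W.edges ∧ ¬ (LatticeModels.meshGraph Ω δ).Adj x y) :
    ∃ x y : LatticeModels.Site 2, x ∈ W.support ∧ x ∈ LatticeModels.meshBoundary Ω δ ∧ (LatticeModels.zdGraph 2).Adj x y ∧
      (openGraph ω ⊓ LatticeModels.discreteDomainGraph Ω δ).Reachable y₀ x ∧ ¬ segment ℝ (LatticeModels.meshPoint δ x) (LatticeModels.meshPoint δ y) ⊆ Ω := by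
  rcases exists_exit_or_forall_mem W hy₀ hopen with h | ⟨-, h⟩
  · obtain ⟨x, y, hx, hxy, -, hxd, hxr, hnadj, hseg⟩ := h
    exact ⟨x, y, hx, ⟨hxd, y, hxy, hnadj⟩, hxy, hxr, hseg⟩
  · obtain ⟨x, y, he, hn⟩ := hbad
    exact absurd (h x y he) hn

end

end Literature.Probability.Percolation
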